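import Mathlib
import Summits.Ventures.HodgeRepro.Tier4.Target
import Summits.Ventures.HodgeRepro.Tier4.Line3.Defs
import Summits.Ventures.HodgeRepro.Tier4.Line3.DefsLemmas
import Summits.Ventures.HodgeRepro.Tier4.Line3.LocaliserS
import Summits.Ventures.HodgeRepro.Tier4.Line3.DefiniteBound
import Summits.Ventures.HodgeRepro.Tier4.Line3.InvariantMajorantDef
import Summits.Ventures.HodgeRepro.Tier4.Line3.InvariantClassBound
import Summits.Ventures.HodgeRepro.Tier4.Line3.InvariantRouteAssembly
import Summits.Ventures.HodgeRepro.Tier4.Line3.InvariantRouteFinal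

/-!
# Tier4/Line3/GrowthInvOfGauss — the `Γ`-invariant growth clause from a pointwise Gaussian bound

Blind re-derivation cell `pub-hodge-repro`, Tier 4 «PROVE THE STEP» (README §9–§10), LINE L3, seat t4-L2-p1 g2
(lead S13124: the line-table row for L3.5's `GrowthInv` input).

The invariant route of L3.5 (t4-L2-p3 g2, `term_dominated_of_growthInv`, InvariantRouteAssembly p674244) displays the
clause `GrowthInv D p L₀ xm ℓ` (InvariantClassBound p673954): the coefficient of the depth-`N` localiser is bounded by
the slot majorant `quadMaj e c₀ x g` at EVERY `Γ`-translate `g ∈ Γ⁴` of the slots, times the definite Gaussian of the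
quadruple, with geometric room `q₂^N`.  This module shows that the `Γ`-quantified clause is IMPLIED by a POINTWISE one
with no reference to `Γ` and no polynomial factor at `τ₀`:

  `‖coefQ (loc N) (rep w)‖ ≤ B · q₂^N · ∏_k gaussDefAt c₀ (rep w k)`   (bounded content × definite Gaussians)

— the shape of the genuine coefficient system (a bounded Schwartz–Bruhat content times the Gaussians
`e^{−π H_σ(x,x)}` of the definite places, the Hecke translates of depth `N` contributing the room `q₂^N`).  The
mathematics is the invariance of the definite Gaussians under `U(H)`: at a definite embedding `σ` the form
`H_σ` is positive (or negative) definite, so it is comparable to the Euclidean norm on both sides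
(`exists_pos_mul_sum_norm_sq_le_re_dotProduct_mulVec`: a positive-definite matrix dominates `λ · ‖v‖²` — compactness
of the unit sphere; `norm_map_hform_le`: it is dominated by `K_σ · ‖v‖²`), and `H_σ(γx, γx) = H_σ(x, x)` for
`γ ∈ U(H)(E′)` (`hform_unitary`).  Hence `Σ_i ‖σ (γx)_i‖² ≤ R · Σ_i ‖σ x_i‖²` with `R` independent of `γ` and `x`
(`exists_uniform_comparability`), the Gaussian at `x` is the product of two half-Gaussians, and one half moves to any
`Γ`-translate at the cost of the constant `c₀ ↦ c₀ / (2R)` (`gaussDefAt_mul_self`, `gaussDefAt_le_of_unitary`).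
With `e = 0` the polynomial factor of `slotMaj` is `1`, so `GrowthInv` holds with `(max B 0, q₂, 0, c₀ / (2R))`
(`growthInv_of_gaussGrowth`); composed with t4-L2-p3's assembly `term_dominated_of_growthInv` this gives L3.5's
conclusion from the pointwise clause, a `Γ`-stable support set, a fundamental domain and the theta mass
(`term_dominated_of_gaussGrowth`), and with t4-L2-p3's final form `term_dominated_of_growthInv_lit` (InvariantRouteFinal
p674963) L3.5's conclusion from the pointwise clause and Borel–Harish-Chandra ALONE (`term_dominated_of_gaussGrowth_lit`).

What this does NOT do: derive `GrowthInv` from the interface clause `LocS.growth` when its exponent `e` is positive —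
the factor `(1 + ‖ballCoord x‖)^e` at the signature-`(2,1)` place is not controlled by the definite Gaussians and is
not `Γ`-invariant; the pointwise clause above is the honest input (row for the line table).  Nothing here asserts
anything about the truth of (P); HC_CM is NOT proved by anyone in this repository.
-/

set_option autoImplicit false

noncomputable section

namespace Summit.Ventures.HodgeRepro.Tier4.Line3

open Summit.Ventures.HodgeRepro.Tier4
open Matrix NumberField
open scoped ComplexConjugate ComplexOrder

/-! ### A positive-definite `3 × 3` complex matrix dominates a multiple of the Euclidean norm -/

section PosDefBounds

/-- The quadratic form of `M` scales by `t²` under a real scalar `t`. -/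
theorem re_dotProduct_mulVec_real_smul (M : Matrix (Fin 3) (Fin 3) ℂ) (t : ℝ) (v : Fin 3 → ℂ) :
    (star ((t : ℂ) • v) ⬝ᵥ (M *ᵥ ((t : ℂ) • v))).re = t ^ 2 * (star v ⬝ᵥ (M *ᵥ v)).re := by
  rw [star_smul, Matrix.mulVec_smul, smul_dotProduct, dotProduct_smul, smul_eq_mul, smul_eq_mul,
    Complex.star_def, Complex.conj_ofReal, Complex.re_ofReal_mul, Complex.re_ofReal_mul]
  ring

/-- **A positive-definite matrix dominates a multiple of the squared Euclidean norm**: `λ · Σ_i ‖v i‖² ≤ Re (v^* M v)`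
for some `λ > 0` (the minimum of the form on the compact unit sphere, scaled). -/
theorem exists_pos_mul_sum_norm_sq_le_re_dotProduct_mulVec {M : Matrix (Fin 3) (Fin 3) ℂ} (hM : M.PosDef) :
    ∃ lam : ℝ, 0 < lam ∧ ∀ v : Fin 3 → ℂ, lam * ∑ i, ‖v i‖ ^ 2 ≤ (star v ⬝ᵥ (M *ᵥ v)).re := by
  set f : (Fin 3 → ℂ) → ℝ := fun v => (star v ⬝ᵥ (M *ᵥ v)).re with hf
  have hcont : Continuous f :=
    Complex.continuous_re.comp (continuous_star.dotProduct (continuous_const.matrix_mulVec continuous_id))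
  have hS : IsCompact (Metric.sphere (0 : Fin 3 → ℂ) 1) := isCompact_sphere 0 1
  have hne : (Metric.sphere (0 : Fin 3 → ℂ) 1).Nonempty := NormedSpace.sphere_nonempty.mpr zero_le_one
  obtain ⟨v₀, hv₀, hmin⟩ := hS.exists_isMinOn hne hcont.continuousOn
  have hv₀ne : v₀ ≠ 0 := by
    intro h
    rw [mem_sphere_zero_iff_norm, h, norm_zero] at hv₀
    exact zero_ne_one hv₀
  have hμ : 0 < f v₀ := by
    have h := hM.dotProduct_mulVec_pos hv₀ne
    exact (Complex.pos_iff.mp h).1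
  refine ⟨f v₀ / 3, by positivity, fun v => ?_⟩
  by_cases hv : v = 0
  · subst hv
    simp [f]
  · have ht : 0 < ‖v‖ := norm_pos_iff.mpr hv
    set u : Fin 3 → ℂ := ((‖v‖⁻¹ : ℝ) : ℂ) • v with hu
    have hu_mem : u ∈ Metric.sphere (0 : Fin 3 → ℂ) 1 := by
      rw [mem_sphere_zero_iff_norm, hu, norm_smul, Complex.norm_real, Real.norm_eq_abs, abs_of_pos (inv_pos.mpr ht),
        inv_mul_cancel₀ ht.ne']
    have hvu : v = ((‖v‖ : ℝ) : ℂ) • u := by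
      rw [hu, smul_smul, ← Complex.ofReal_mul, mul_inv_cancel₀ ht.ne', Complex.ofReal_one, one_smul]
    have hfu : f v₀ ≤ f u := hmin hu_mem
    have hfv : f v = ‖v‖ ^ 2 * f u := by
      simp only [f]
      conv_lhs => rw [hvu]
      exact re_dotProduct_mulVec_real_smul M ‖v‖ u
    have hsum : ∑ i, ‖v i‖ ^ 2 ≤ 3 * ‖v‖ ^ 2 := by
      have h3 : ∀ i, ‖v i‖ ^ 2 ≤ ‖v‖ ^ 2 := fun i =>
        sq_le_sq' (by linarith [norm_nonneg (v i), norm_le_pi_norm v i]) (norm_le_pi_norm v i)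
      calc ∑ i, ‖v i‖ ^ 2 ≤ ∑ _i : Fin 3, ‖v‖ ^ 2 := Finset.sum_le_sum fun i _ => h3 i
        _ = 3 * ‖v‖ ^ 2 := by simp
    calc f v₀ / 3 * ∑ i, ‖v i‖ ^ 2 ≤ f v₀ / 3 * (3 * ‖v‖ ^ 2) :=
          mul_le_mul_of_nonneg_left hsum (by positivity)
      _ = ‖v‖ ^ 2 * f v₀ := by ring
      _ ≤ ‖v‖ ^ 2 * f u := mul_le_mul_of_nonneg_left hfu (by positivity)
      _ = f v := hfv.symm

end PosDefBounds

namespace T4Data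

variable (X : T4Data)

/-! ### Comparability of the Euclidean norm under `U(H)` at a definite embedding -/

/-- `σ ∘ c = conj ∘ σ` at every complex embedding of the CM field `E′` (Mathlib
`IsCMField.complexEmbedding_complexConj`). -/
theorem emb_c_eq_conj (σ : X.E →+* ℂ) (t : X.E) : σ (X.c t) = conj (σ t) :=
  IsCMField.complexEmbedding_complexConj X.E σ t

/-- The embedded hermitian form is the quadratic form of the embedded matrix: `σ ⟨y, y⟩_H = (σ y)^* (σ H) (σ y)`. -/
theorem map_hform_eq_dotProduct (σ : X.E →+* ℂ) (y : Fin 3 → X.E) :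
    σ (hform X.c X.H y y) = star (fun i => σ (y i)) ⬝ᵥ ((X.H.map σ) *ᵥ fun i => σ (y i)) := by
  simp only [hform, dotProduct, Matrix.mulVec, map_sum, map_mul, Matrix.map_apply, Pi.star_apply,
    Complex.star_def, X.emb_c_eq_conj]

/-- **Comparability at one embedding**: at a definite embedding `σ` (and trivially at the others), there is `R ≥ 1`
with `Σ_i ‖σ (γx)_i‖² ≤ R · Σ_i ‖σ x_i‖²` for every `γ ∈ U(H)(E′)` and every `x`. -/
theorem exists_comparability (σ : X.E →+* ℂ) :
    ∃ R : ℝ, 1 ≤ R ∧ (σ ≠ X.τ₀ → σ ≠ conjEmb X.τ₀ →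
      ∀ γ : Matrix (Fin 3) (Fin 3) X.E, IsUnitaryOf X.c X.H γ → ∀ x : Fin 3 → X.E,
        ∑ i, ‖σ ((γ *ᵥ x) i)‖ ^ 2 ≤ R * ∑ i, ‖σ (x i)‖ ^ 2) := by
  by_cases hdef : σ ≠ X.τ₀ ∧ σ ≠ conjEmb X.τ₀
  · obtain ⟨hσ, hσ'⟩ := hdef
    have hσc : ∀ t, ‖σ (X.c t)‖ = ‖σ t‖ := fun t => by rw [X.emb_c_eq_conj, Complex.norm_conj]
    -- the positive-definite matrix `M' = ± σ(H)` and its lower bound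
    have hD := X.hDef σ hσ hσ'
    have hlow : ∃ lam : ℝ, 0 < lam ∧ ∀ v : Fin 3 → ℂ,
        lam * ∑ i, ‖v i‖ ^ 2 ≤ ‖star v ⬝ᵥ ((X.H.map σ) *ᵥ v)‖ := by
      rcases hD with hpos | hneg
      · obtain ⟨lam, hlam, h⟩ := exists_pos_mul_sum_norm_sq_le_re_dotProduct_mulVec hpos
        exact ⟨lam, hlam, fun v => (h v).trans (Complex.re_le_norm _)⟩
      · obtain ⟨lam, hlam, h⟩ := exists_pos_mul_sum_norm_sq_le_re_dotProduct_mulVec hneg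
        refine ⟨lam, hlam, fun v => ?_⟩
        calc lam * ∑ i, ‖v i‖ ^ 2 ≤ (star v ⬝ᵥ ((-(X.H.map σ)) *ᵥ v)).re := h v
          _ = (-(star v ⬝ᵥ ((X.H.map σ) *ᵥ v))).re := by rw [Matrix.neg_mulVec, dotProduct_neg]
          _ ≤ ‖-(star v ⬝ᵥ ((X.H.map σ) *ᵥ v))‖ := Complex.re_le_norm _
          _ = ‖star v ⬝ᵥ ((X.H.map σ) *ᵥ v)‖ := norm_neg _
    obtain ⟨lam, hlam, hlow⟩ := hlow
    set K : ℝ := ∑ k, ∑ l, ‖σ (X.H k l)‖ with hK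
    refine ⟨max 1 (2 * K / lam), le_max_left _ _, fun _ _ γ hγ x => ?_⟩
    have hform_eq : hform X.c X.H (γ *ᵥ x) (γ *ᵥ x) = hform X.c X.H x x := X.hform_unitary hγ x x
    have h1 : lam * ∑ i, ‖σ ((γ *ᵥ x) i)‖ ^ 2 ≤ ‖σ (hform X.c X.H x x)‖ := by
      rw [← hform_eq, X.map_hform_eq_dotProduct]
      exact hlow _
    have h2 : ‖σ (hform X.c X.H x x)‖ ≤ K * (2 * ∑ i, ‖σ (x i)‖ ^ 2) := by
      have := norm_map_hform_le X.c X.H σ hσc x x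
      rw [hK]
      linarith [this]
    have hK0 : 0 ≤ K := Finset.sum_nonneg fun _ _ => Finset.sum_nonneg fun _ _ => norm_nonneg _
    have hsum0 : 0 ≤ ∑ i, ‖σ (x i)‖ ^ 2 := Finset.sum_nonneg fun _ _ => by positivity
    calc ∑ i, ‖σ ((γ *ᵥ x) i)‖ ^ 2 = (lam * ∑ i, ‖σ ((γ *ᵥ x) i)‖ ^ 2) / lam := by
          field_simp
      _ ≤ (K * (2 * ∑ i, ‖σ (x i)‖ ^ 2)) / lam :=
          div_le_div_of_nonneg_right (h1.trans h2) hlam.le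
      _ = (2 * K / lam) * ∑ i, ‖σ (x i)‖ ^ 2 := by
          field_simp
      _ ≤ max 1 (2 * K / lam) * ∑ i, ‖σ (x i)‖ ^ 2 :=
          mul_le_mul_of_nonneg_right (le_max_right _ _) hsum0
  · refine ⟨1, le_rfl, fun hσ hσ' => absurd ⟨hσ, hσ'⟩ hdef⟩

/-- **Uniform comparability**: one `R ≥ 1` for all definite embeddings, all `γ ∈ U(H)(E′)`, all `x`. -/
theorem exists_uniform_comparability :
    ∃ R : ℝ, 1 ≤ R ∧ ∀ σ : X.E →+* ℂ, σ ≠ X.τ₀ → σ ≠ conjEmb X.τ₀ →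
      ∀ γ : Matrix (Fin 3) (Fin 3) X.E, IsUnitaryOf X.c X.H γ → ∀ x : Fin 3 → X.E,
        ∑ i, ‖σ ((γ *ᵥ x) i)‖ ^ 2 ≤ R * ∑ i, ‖σ (x i)‖ ^ 2 := by
  choose R hR1 hR using X.exists_comparability
  obtain ⟨σ₀⟩ : Nonempty (X.E →+* ℂ) := inferInstance
  have hR0 : ∀ σ, 0 ≤ R σ := fun σ => zero_le_one.trans (hR1 σ)
  have hle : ∀ σ, R σ ≤ ∑ σ' : X.E →+* ℂ, R σ' := fun σ =>
    Finset.single_le_sum (f := R) (fun σ' _ => hR0 σ') (Finset.mem_univ σ)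
  refine ⟨∑ σ' : X.E →+* ℂ, R σ', (hR1 σ₀).trans (hle σ₀), fun σ hσ hσ' γ hγ x => ?_⟩
  have hsum0 : 0 ≤ ∑ i, ‖σ (x i)‖ ^ 2 := Finset.sum_nonneg fun _ _ => by positivity
  exact (hR σ hσ hσ' γ hγ x).trans (mul_le_mul_of_nonneg_right (hle σ) hsum0)

/-! ### The definite Gaussian: product form, monotonicity, the half moved to a unitary translate -/

open scoped Classical in
/-- `gaussDefAt` as a `Finset` product over the definite embeddings. -/
theorem gaussDefAt_eq_prod (c₀ : ℝ) (x : Fin 3 → X.E) :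
    X.gaussDefAt c₀ x = ∏ σ ∈ Finset.univ.filter (fun σ : X.E →+* ℂ => σ ≠ X.τ₀ ∧ σ ≠ conjEmb X.τ₀),
      Real.exp (-(c₀ * ∑ i, ‖σ (x i)‖ ^ 2)) := by
  unfold gaussDefAt
  exact finprod_cond_eq_prod_of_cond_iff _ fun {σ} _ => by simp

/-- The Gaussian at `c₀` is the square of the Gaussian at `c₀ / 2`. -/
theorem gaussDefAt_half_mul_self (c₀ : ℝ) (x : Fin 3 → X.E) :
    X.gaussDefAt (c₀ / 2) x * X.gaussDefAt (c₀ / 2) x = X.gaussDefAt c₀ x := by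
  classical
  rw [X.gaussDefAt_eq_prod, X.gaussDefAt_eq_prod, ← Finset.prod_mul_distrib]
  refine Finset.prod_congr rfl fun σ _ => ?_
  rw [← Real.exp_add]
  congr 1
  ring

/-- `gaussDefAt` is antitone in the constant. -/
theorem gaussDefAt_anti {c₁ c₂ : ℝ} (h : c₁ ≤ c₂) (x : Fin 3 → X.E) :
    X.gaussDefAt c₂ x ≤ X.gaussDefAt c₁ x := by
  classical
  rw [X.gaussDefAt_eq_prod, X.gaussDefAt_eq_prod]
  refine Finset.prod_le_prod (fun σ _ => (Real.exp_pos _).le) fun σ _ => ?_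
  apply Real.exp_le_exp.mpr
  have hs : 0 ≤ ∑ i, ‖σ (x i)‖ ^ 2 := Finset.sum_nonneg fun _ _ => by positivity
  nlinarith [mul_le_mul_of_nonneg_right h hs]

/-- **Half of the Gaussian moves to a unitary translate**: with `R` the uniform comparability constant and `c ≥ 0`,
`gaussDefAt (c · R) x ≤ gaussDefAt c (γ x)` for every `γ ∈ U(H)(E′)`. -/
theorem gaussDefAt_le_of_unitary {R : ℝ}
    (hR : ∀ σ : X.E →+* ℂ, σ ≠ X.τ₀ → σ ≠ conjEmb X.τ₀ →
      ∀ γ : Matrix (Fin 3) (Fin 3) X.E, IsUnitaryOf X.c X.H γ → ∀ x : Fin 3 → X.E,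
        ∑ i, ‖σ ((γ *ᵥ x) i)‖ ^ 2 ≤ R * ∑ i, ‖σ (x i)‖ ^ 2)
    {c : ℝ} (hc : 0 ≤ c) {γ : Matrix (Fin 3) (Fin 3) X.E} (hγ : IsUnitaryOf X.c X.H γ) (x : Fin 3 → X.E) :
    X.gaussDefAt (c * R) x ≤ X.gaussDefAt c (γ *ᵥ x) := by
  classical
  rw [X.gaussDefAt_eq_prod, X.gaussDefAt_eq_prod]
  refine Finset.prod_le_prod (fun σ _ => (Real.exp_pos _).le) fun σ hσ => ?_
  rw [Finset.mem_filter] at hσ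
  apply Real.exp_le_exp.mpr
  have := mul_le_mul_of_nonneg_left (hR σ hσ.2.1 hσ.2.2 γ hγ x) hc
  linarith [this]

/-! ### The `Γ`-invariant growth clause from the pointwise Gaussian bound -/

/-- The slot majorant at exponent `0` is the definite Gaussian alone. -/
theorem slotMaj_zero (c₁ : ℝ) (y : Fin 3 → X.E) : X.slotMaj 0 c₁ y = X.gaussDefAt c₁ y := by
  unfold slotMaj
  rw [Real.rpow_zero, one_mul]

/-- Elements of `Γ` are unitary for `H` (`Γ ⊆ Γ(1)`). -/
theorem isUnitaryOf_of_mem_Γ {γ : Matrix (Fin 3) (Fin 3) X.E} (hγ : γ ∈ X.Γ) : IsUnitaryOf X.c X.H γ :=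
  (X.hΓ.2.2.2.1 hγ).1

/-- **THE `Γ`-INVARIANT GROWTH CLAUSE FROM A POINTWISE GAUSSIAN BOUND.** If the coefficients of the localiser satisfy
`‖coefQ (loc N) (rep w)‖ ≤ B · q₂^N · ∏_k gaussDefAt c₀ (rep w k)` (bounded content times the definite Gaussians of the
quadruple, geometric room in the depth — no polynomial factor at `τ₀`, no reference to `Γ`), then `GrowthInv` holds
with exponent `e = 0` and the constant `c₀ / (2R)`, `R` the uniform comparability constant of `U(H)` at the definite
embeddings. -/
theorem growthInv_of_gaussGrowth (D : X.ThetaData)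
    {p : IsDedekindDomain.HeightOneSpectrum (RingOfIntegers X.E)}
    {L₀ : Submodule (RingOfIntegers X.E) (Fin 3 → X.E)} {xm : X.Tuple} (ℓ : X.LocS D p L₀ xm)
    (hg : ∃ B q₂ c₀ : ℝ, 0 < c₀ ∧ 0 ≤ q₂ ∧ ∀ (N : ℕ) (w : X.LineTuple),
      ‖X.coefQ D.cf (ℓ.loc N) (X.rep w)‖ ≤ B * q₂ ^ N * ∏ k, X.gaussDefAt c₀ (X.rep w k)) :
    X.GrowthInv D p L₀ xm ℓ := by
  obtain ⟨B, q₂, c₀, hc₀, hq₂, hbound⟩ := hg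
  obtain ⟨R, hR1, hR⟩ := X.exists_uniform_comparability
  have hRpos : 0 < R := zero_lt_one.trans_le hR1
  set c : ℝ := c₀ / (2 * R) with hc
  have hcpos : 0 < c := by positivity
  have hcR : c * R = c₀ / 2 := by
    rw [hc]
    field_simp
  have hc_le : c ≤ c₀ / 2 := by
    rw [hc, div_le_div_iff₀ (by positivity) (by positivity)]
    nlinarith [hc₀, hR1]
  refine ⟨max B 0, q₂, 0, c, hcpos, hq₂, fun N w g => ?_⟩
  refine (hbound N w).trans ?_
  have hprod0 : 0 ≤ ∏ k, X.gaussDefAt c₀ (X.rep w k) :=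
    Finset.prod_nonneg fun k _ => X.gaussDefAt_nonneg _ _
  have hq : 0 ≤ q₂ ^ N := pow_nonneg hq₂ N
  -- the Gaussian product of the quadruple is at most the translated half times the untranslated half
  have hmain : ∏ k, X.gaussDefAt c₀ (X.rep w k) ≤
      X.quadMaj 0 c (X.rep w) g * ∏ k, X.gaussDefAt c (X.rep w k) := by
    unfold quadMaj
    rw [← Finset.prod_mul_distrib]
    refine Finset.prod_le_prod (fun k _ => X.gaussDefAt_nonneg _ _) fun k _ => ?_
    rw [X.slotMaj_zero, ← X.gaussDefAt_half_mul_self]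
    refine mul_le_mul ?_ (X.gaussDefAt_anti hc_le _) (X.gaussDefAt_nonneg _ _) (X.gaussDefAt_nonneg _ _)
    rw [← hcR]
    exact X.gaussDefAt_le_of_unitary hR hcpos.le (X.isUnitaryOf_of_mem_Γ (g k).2) _
  calc B * q₂ ^ N * ∏ k, X.gaussDefAt c₀ (X.rep w k)
      ≤ max B 0 * q₂ ^ N * ∏ k, X.gaussDefAt c₀ (X.rep w k) := by
        gcongr
        exact le_max_left _ _
    _ ≤ max B 0 * q₂ ^ N * (X.quadMaj 0 c (X.rep w) g * ∏ k, X.gaussDefAt c (X.rep w k)) := by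
        gcongr
    _ = max B 0 * q₂ ^ N * X.quadMaj 0 c (X.rep w) g * ∏ k, X.gaussDefAt c (X.rep w k) := by ring

/-- **L3.5 FROM THE POINTWISE GAUSSIAN BOUND** on the invariant route: `term_dominated_of_growthInv` (InvariantRouteAssembly
p674244) with `hinv` discharged by `growthInv_of_gaussGrowth`. -/
theorem term_dominated_of_gaussGrowth (D : X.ThetaData)
    (p : IsDedekindDomain.HeightOneSpectrum (RingOfIntegers X.E))
    (L₀ : Submodule (RingOfIntegers X.E) (Fin 3 → X.E)) (xm : X.Tuple)
    (h02 : xm 2 = xm 0) (h13 : xm 3 = xm 1) (hab : LinearIndependent X.E ![xm 0, xm 1]) (ℓ : X.LocS D p L₀ xm)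
    (hg : ∃ B q₂ c₀ : ℝ, 0 < c₀ ∧ 0 ≤ q₂ ∧ ∀ (N : ℕ) (w : X.LineTuple),
      ‖X.coefQ D.cf (ℓ.loc N) (X.rep w)‖ ≤ B * q₂ ^ N * ∏ k, X.gaussDefAt c₀ (X.rep w k))
    {S' : Set X.LineTuple} (hS : X.IsGammaStable S')
    (hsupp : X.SupportIn D p L₀ xm ℓ S') {F : Set (Fin 2 → ℂ)}
    (hF : IsFundamentalDomainFor (ballActions X.τ₀ X.C X.Γ) F)
    (hmass : ∀ e c₁ : ℝ, 0 < c₁ → ∃ M_F : ℝ, 0 ≤ M_F ∧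
      ∫⁻ z in F, X.invMajorantDensity D S' xm e c₁ z ≤ ENNReal.ofReal M_F) :
    ∃ bound : X.Orbit → ℝ, (∀ o, 0 ≤ bound o) ∧ Summable bound ∧
      ∀ N (o : X.Orbit), o ≠ X.orbitOf (X.lines xm) →
        ‖X.term D.Φ D.cf (ℓ.level N) (ℓ.loc N) o‖ ≤ bound o :=
  X.term_dominated_of_growthInv D p L₀ xm h02 h13 hab ℓ (X.growthInv_of_gaussGrowth D ℓ hg) hS hsupp hF hmass

/-- **L3.5 FROM THE POINTWISE GAUSSIAN BOUND AND BOREL–HARISH-CHANDRA ALONE**: `term_dominated_of_growthInv_lit`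
(InvariantRouteFinal p674963 — the `Γ`-stable support lattice, the theta mass over the relatively compact domain of
`hlit`, all by name) with `hinv` discharged by `growthInv_of_gaussGrowth`. -/
theorem term_dominated_of_gaussGrowth_lit (D : X.ThetaData)
    (p : IsDedekindDomain.HeightOneSpectrum (RingOfIntegers X.E))
    (L₀ : Submodule (RingOfIntegers X.E) (Fin 3 → X.E)) (xm : X.Tuple)
    (h02 : xm 2 = xm 0) (h13 : xm 3 = xm 1) (hab : LinearIndependent X.E ![xm 0, xm 1]) (ℓ : X.LocS D p L₀ xm)
    (hg : ∃ B q₂ c₀ : ℝ, 0 < c₀ ∧ 0 ≤ q₂ ∧ ∀ (N : ℕ) (w : X.LineTuple),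
      ‖X.coefQ D.cf (ℓ.loc N) (X.rep w)‖ ≤ B * q₂ ^ N * ∏ k, X.gaussDefAt c₀ (X.rep w k))
    (hlit : Lit.BorelHarishChandra1962_Thm11_8_fundamentalDomain_hdef X.E X.H X.τ₀ X.C) :
    ∃ bound : X.Orbit → ℝ, (∀ o, 0 ≤ bound o) ∧ Summable bound ∧
      ∀ N (o : X.Orbit), o ≠ X.orbitOf (X.lines xm) →
        ‖X.term D.Φ D.cf (ℓ.level N) (ℓ.loc N) o‖ ≤ bound o :=
  X.term_dominated_of_growthInv_lit D p L₀ xm h02 h13 hab ℓ (X.growthInv_of_gaussGrowth D ℓ hg) hlit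

end T4Data

end Summit.Ventures.HodgeRepro.Tier4.Line3

end
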